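import Literature.MathematicalPhysics.QuantumLattice.HubbardEnergyDensityVariationalPrinciple
import Literature.MathematicalPhysics.QuantumLattice.HubbardTorusLocalCertificate
import HarnessLib

/-!
# Thermodynamic-limit states of square-lattice sector ground states (the state class "(I)" in `d = 2`)

Topic `MathematicalPhysics/QuantumLattice`. The two-dimensional counterpart of
`HubbardChainTorusLimitState.lean`. Ruelle's ground-state energy density `energyDensity2D t U n` of the
square-lattice Hubbard model (`U ≥ 0`, `0 ≤ n < 2`) is carried by a translation-invariant, even
infinite-volume state `ω` on `ℤ²` that is a TORUS LIMIT of unit ground states of the tori `(ℤ/Lℤ)²` in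
the joint sectors `(N, S^z) = (2⌊n L²/2⌋, 0)` (tree: `exists_isTranslationInvariant_hubbardEnergyDensity_eq`,
whose proof is exactly this construction; here the witnesses are kept,
`exists_isTorusLimitOf_squareGroundStates_hubbardEnergyDensity_eq`). Such a state has particle density
`n` AND — because the sectors have `S^z = 0` — spin densities `ω(n_{0↑}) = ω(n_{0↓}) = n/2`
(`IsTorusLimitOf.expect_nAt_eq_of_szSector`, from the averaged torus identity
`torusAvgExpect_nAt_of_mem_szSector`: the translation average of `⟨n_{0σ}⟩` in an `(N, S^z = 0)` unit
vector is `N/(2 L^d)`, Lieb 1989 eq. (2)).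

**Transport corollary** (`le_energyDensity2D_of_forall_torusLimit`): a real number that bounds from below
the Hubbard energy density of every such state bounds `energyDensity2D t U n` from below. This is the
hypothesis class of square-lattice bootstrap certificates whose rows hold for translation-invariant states
of the INFINITE lattice but not on finite tori (e.g. the Pauli–Markov one-body / matrix cuts of
`Summits/Ventures/CertifiedManyBodySolver/Transport/PauliMarkovMatrix*.lean`, whose constant matrix
`C(ν)` needs the spin density `ν = n/2` supplied here), exactly as
`le_hubbardChainEnergyDensityAt_of_forall_torusLimit` is for the chain. Everything is PROVED; no
definition, no named fact.

## References
* D. Ruelle, *Statistical Mechanics: Rigorous Results* (Benjamin 1969), §3.3–3.4 (periodic boxes;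
  states of given density). [cite: Ruelle1969, §3.4]
* O. Bratteli, A. Kishimoto, D. W. Robinson, Commun. Math. Phys. 64 (1978) 41–48, §3 Thm. 2 (ground
  states minimise the mean energy). [cite: BratteliKishimotoRobinson1978, §3]
* E. H. Lieb, *Two theorems on the Hubbard model*, Phys. Rev. Lett. 62 (1989) 1201, eq. (2) and proof of
  Thm. 1 (`S^z = 0` sectors; `N_σ = N/2`). [cite: LiebPRL1989, eq. (2)]
-/

noncomputable section

namespace Literature.MathematicalPhysics.QuantumLattice

open Matrix Finset HubbardWave0 _root_.Filter Literature.Probability.LatticeModels ThermodynamicLimit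
open scoped _root_.Topology ComplexOrder

variable {d : ℕ}

/-! ### The averaged spin density of an `(N, S^z = 0)` torus vector -/

/-- **The averaged spin-`σ` density of an `(N, S^z = 0)` unit vector is `N/(2L^d)`**: for `L ≠ 0`,
the translation-averaged expectation of `n_{0σ} ∈ 𝔄_{{0}}` in a unit vector of the joint sector
`(N, S^z = 0)` of the torus of side `L` equals `(N/2) / L^d` (the translates of `n_{0σ}` exhaust the
spin-`σ` number, which acts as `N/2` on the sector). [cite: LiebPRL1989, eq. (2)] -/
theorem torusAvgExpect_nAt_of_mem_szSector (L : ℕ) [NeZero L] (σ : Fin 2) {N : ℕ}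
    {ψ : Fock (Orb (FermionTorus d L))} (hψS : ψ ∈ szSector N 0) (hψ : star ψ ⬝ᵥ ψ = 1) :
    torusAvgExpect L ({0} : Finset (Site d)) (nAt 0 (Finset.mem_singleton_self 0) σ) ψ =
      ((((N : ℝ) / 2 : ℝ) : ℂ)) / ((L : ℂ) ^ d) := by
  have h := injOn_proj_singleton (d := d) L 0
  have hcard : Fintype.card (TorusSite d L) = L ^ d := by simp [ZMod.card, Fintype.card_fin]
  have hproj : Torus.proj L (0 : Site d) = 0 := by funext i; simp [Torus.proj]
  rw [torusAvgExpect_eq, torusAvgExpectAt_of_injOn L h, hcard, Nat.cast_pow, div_eq_inv_mul]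
  congr 1
  have hn : fermionEmbed (PolySite.toTorusEmb L h) (nAt 0 (Finset.mem_singleton_self 0) σ) =
      numberOp (FermionTorus.ofTorusSite (0 : TorusSite d L)) σ := by
    rw [nAt, fermionEmbed_numberOp, PolySite.toTorusEmb_apply, PolySite.ofLex_coe_pt, hproj]
  rw [hn, sum_expect_numberOp_fockTranslate, expect, spinNumber_mulVec_of_mem_szSector σ hψS,
    dotProduct_smul, hψ, smul_eq_mul, mul_one]

/-- **The spin densities of a thermodynamic-limit state of `S^z = 0` families.** Let `ω` be a torus
limit of `ψ` along sides `Ls → ∞`, the `ψ (Ls j)` being unit vectors of the sectors `(N j, S^z = 0)`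
with `N j / (Ls j)^d → ρ`. Then `ω(n_{0σ}) = ρ/2` for both spins. [cite: Ruelle1969, §3.4] -/
theorem InfVolFermionState.IsTorusLimitOf.expect_nAt_eq_of_szSector {ω : InfVolFermionState d}
    {ψ : ∀ L, Fock (Orb (FermionTorus d L))} {Ls : ℕ → ℕ} (h : ω.IsTorusLimitOf ψ Ls)
    (hLs : Tendsto Ls atTop atTop) {N : ℕ → ℕ} (hS : ∀ j, ψ (Ls j) ∈ szSector (N j) 0)
    (hψ : ∀ j, star (ψ (Ls j)) ⬝ᵥ ψ (Ls j) = 1) {ρ : ℝ}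
    (hρ : Tendsto (fun j => (N j : ℝ) / (Ls j : ℝ) ^ d) atTop (𝓝 ρ)) (σ : Fin 2) :
    ω.expect {0} (nAt 0 (Finset.mem_singleton_self 0) σ) = (((ρ / 2 : ℝ)) : ℂ) := by
  have hlim := h ({0} : Finset (Site d)) (nAt 0 (Finset.mem_singleton_self 0) σ)
  have hρ2 : Tendsto (fun j => (N j : ℝ) / 2 / (Ls j : ℝ) ^ d) atTop (𝓝 (ρ / 2)) := by
    have := hρ.div_const 2
    refine this.congr fun j => ?_
    ring
  have hρ' : Tendsto (fun j => ((((N j : ℝ) / 2 / (Ls j : ℝ) ^ d : ℝ)) : ℂ)) atTop (𝓝 (((ρ / 2 : ℝ)) : ℂ)) :=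
    (Complex.continuous_ofReal.tendsto _).comp hρ2
  have heq : ∀ᶠ j in atTop, torusAvgExpect (Ls j) ({0} : Finset (Site d))
      (nAt 0 (Finset.mem_singleton_self 0) σ) (ψ (Ls j)) = ((((N j : ℝ) / 2 / (Ls j : ℝ) ^ d : ℝ)) : ℂ) := by
    filter_upwards [hLs.eventually_ge_atTop 1] with j hj
    haveI : NeZero (Ls j) := ⟨Nat.one_le_iff_ne_zero.1 hj⟩
    rw [torusAvgExpect_nAt_of_mem_szSector (Ls j) σ (hS j) (hψ j)]
    push_cast
    rfl
  exact tendsto_nhds_unique hlim (hρ'.congr' (heq.mono fun j hj => hj.symm))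

/-! ### The state class (I) of the square lattice and the transport of lower bounds -/

section Square

variable (t : ℝ)

/-- **Square-lattice sector ground states have translation-invariant thermodynamic-limit states
carrying `energyDensity2D`.** For `U ≥ 0` and `0 ≤ n < 2` there are: a family `ψ` of unit vectors on
the tori `(ℤ/Lℤ)²`, sides `L_j → ∞`, on which the `ψ (L_j)` are ground states of `hubbardTorus 2 L_j t U`
in the sectors `(2⌊n L_j²/2⌋, S^z = 0)`, and an infinite-volume state `ω` on `ℤ²` that is their torus
limit — translation invariant and even, of particle density `n`, spin densities
`ω(n_{0↑}) = ω(n_{0↓}) = n/2`, with `ω.hubbardEnergyDensity t U = energyDensity2D t U n`.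
[cite: Ruelle1969, §3.4; BratteliKishimotoRobinson1978, §3] -/
theorem exists_isTorusLimitOf_squareGroundStates_hubbardEnergyDensity_eq {U : ℝ} (hU : 0 ≤ U)
    {n : ℝ} (hn0 : 0 ≤ n) (hn2 : n < 2) :
    ∃ (ψ : ∀ L, Fock (Orb (FermionTorus 2 L))) (Ls : ℕ → ℕ) (ω : InfVolFermionState 2),
      Tendsto Ls atTop atTop ∧ ω.IsTorusLimitOf ψ Ls ∧ ω.IsTranslationInvariant ∧ ω.IsEven ∧
      (∀ j, star (ψ (Ls j)) ⬝ᵥ ψ (Ls j) = 1) ∧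
      (∀ j, IsGroundStateInSector (hubbardTorus 2 (Ls j) t U) (rectN n (Ls j)) 0 (ψ (Ls j))) ∧
      ω.density = n ∧
      (∀ σ : Fin 2, ω.expect {0} (nAt 0 (Finset.mem_singleton_self 0) σ) = (((n / 2 : ℝ)) : ℂ)) ∧
      ω.hubbardEnergyDensity t U = energyDensity2D t U n := by
  choose ψ hψ using InfVolFermionState.exists_unit_isGroundStateInSector_rectN t U hn2.le
  have hN : ∀ L, IsNParticle (rectN n L) (ψ L) := fun L => ((mem_szSector_iff _ _ _).1 (hψ L).2.1).1
  obtain ⟨φ, hφ, ω, hω, hti, hev⟩ :=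
    InfVolFermionState.exists_isTorusLimitOf_subseq_of_isNParticle ψ hN tendsto_id fun j => (hψ j).1
  have hφ' : Tendsto (id ∘ φ) atTop atTop := hφ.tendsto_atTop
  refine ⟨ψ, id ∘ φ, ω, hφ', hω, hti, hev, fun j => (hψ _).1, fun j => (hψ _).2, ?_, ?_, ?_⟩
  · exact hω.density_eq_of_rectN hφ' hn0 (fun j => hN _) fun j => (hψ _).1
  · intro σ
    exact hω.expect_nAt_eq_of_szSector hφ' (fun j => (hψ _).2.1) (fun j => (hψ _).1)
      ((tendsto_rectN_div_sq hn0).comp hφ') σ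
  · exact hω.hubbardEnergyDensity_eq_energyDensity2D (t := t) hφ' hU hn0 hn2 (fun j => (hψ _).2)
      fun j => (hψ _).1

/-- **Corollary (transport of lower bounds valid for translation-invariant limit states, `d = 2`).**
If a real number `E` is a lower bound on the Hubbard energy density of every translation-invariant, even
infinite-volume state on `ℤ²` of density `n` and spin densities `n/2` that is a torus limit of unit
`(2⌊n L²/2⌋, S^z = 0)`-sector ground states of the tori — the hypothesis class of a square-lattice
bootstrap certificate whose rows hold for translation-invariant states of the infinite lattice
(positivity, translation / point-group identifications, Pauli–Markov cuts, further state inequalities)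
and for limits of torus eigenstates (commutator rows) — then `E ≤ energyDensity2D t U n` (`U ≥ 0`,
`0 ≤ n < 2`). [cite: Ruelle1969, §3.4] -/
theorem le_energyDensity2D_of_forall_torusLimit {U : ℝ} (hU : 0 ≤ U) {n : ℝ} (hn0 : 0 ≤ n) (hn2 : n < 2)
    {E : ℝ}
    (hE : ∀ (ω : InfVolFermionState 2) (ψ : ∀ L, Fock (Orb (FermionTorus 2 L))) (Ls : ℕ → ℕ),
      Tendsto Ls atTop atTop → ω.IsTorusLimitOf ψ Ls → ω.IsTranslationInvariant → ω.IsEven →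
      (∀ j, star (ψ (Ls j)) ⬝ᵥ ψ (Ls j) = 1) →
      (∀ j, IsGroundStateInSector (hubbardTorus 2 (Ls j) t U) (rectN n (Ls j)) 0 (ψ (Ls j))) →
      ω.density = n →
      (∀ σ : Fin 2, ω.expect {0} (nAt 0 (Finset.mem_singleton_self 0) σ) = (((n / 2 : ℝ)) : ℂ)) →
      E ≤ ω.hubbardEnergyDensity t U) :
    E ≤ energyDensity2D t U n := by
  obtain ⟨ψ, Ls, ω, hLs, hω, hti, hev, h1, hgs, hdens, hspin, he⟩ :=
    exists_isTorusLimitOf_squareGroundStates_hubbardEnergyDensity_eq t hU hn0 hn2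
  rw [← he]
  exact hE ω ψ Ls hLs hω hti hev h1 hgs hdens hspin

/-- The same transport without the spin-density and sector data in the hypothesis (for certificates
whose rows use only translation invariance, evenness and the density). [cite: Ruelle1969, §3.4] -/
theorem le_energyDensity2D_of_forall_isTranslationInvariant {U : ℝ} (hU : 0 ≤ U) {n : ℝ} (hn0 : 0 ≤ n)
    (hn2 : n < 2) {E : ℝ}
    (hE : ∀ ω : InfVolFermionState 2, ω.IsTranslationInvariant → ω.IsEven → ω.density = n →
      E ≤ ω.hubbardEnergyDensity t U) :
    E ≤ energyDensity2D t U n := by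
  obtain ⟨ψ, Ls, ω, -, -, hti, hev, -, -, hdens, -, he⟩ :=
    exists_isTorusLimitOf_squareGroundStates_hubbardEnergyDensity_eq t hU hn0 hn2
  rw [← he]
  exact hE ω hti hev hdens

end Square

end Literature.MathematicalPhysics.QuantumLattice

end
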